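import Mathlib
import Summits.Ventures.PercRepro2.MixChordWitness

/-!
# (MIX²): the mixed chord with the squared shrinkage (blind cell PercRepro2, night-1 g19;
NIGHT1-G19.md §9)

The thirteen kit failures of (MIX-CHORD) along a root edge are all failures of its closed-end
term at near-deterministic vectors: the normaliser `D·Z` shrinks by ≤ 10× while `Gc` shrinks by
10²–10³.  Squaring the shrinkage repairs every captured witness (38 / 38 root edges) while keeping
every row that (MIX-CHORD) gave (`mixChord2_of_mixChord`: `λ² ≤ λ` since `PD` and `Q` are lower
sets, `λ ≤ 1`, and `Gc (p[e ↦ 0]) ≥ 0`), so (MIX²) is census-true on all 8,865,534 root edges of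
the four kit jobs:

**(MIX²)** `Gc p ≥ p_e · Gc (p[e ↦ 1]) + (1 − p_e) · shrink² · Gc (p[e ↦ 0])` along every root edge.

The induction is the one of `MixChord.lean` (`HCov_all_of_mixChord2_all`); the witness classes
transfer under the induction hypothesis `Gc (p[e ↦ 0]) ≥ 0` (`mixChord2_of_witnessClass`), and the
narrowed rows `MixChord2Exists_all` / `MixChord2NoWitness_all` close the crux.

Own code; standard axioms.
-/

namespace Summit.Ventures.PercRepro2

open UnionCluster CovForm

namespace Mix

open scoped Classical

section Defs

variable {V : Type*} {E : Type*} [Fintype E] [DecidableEq E] {R : Type*} [Field R]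
  [LinearOrder R]

/-- **(MIX²)** at `p`: the mixed chord with the squared shrinkage along every root edge. -/
def MixChord2 (p : E → R) (ends : E → Sym2 V) (o a₁ a₂ a₃ b : V) : Prop :=
  ∀ e ∈ Chord.rootEdges p ends a₁ a₂,
    p e * Gc (Function.update p e 1) ends o a₁ a₂ a₃ b +
      (1 - p e) * (shrink p ends a₁ a₂ a₃ e ^ 2 * Gc (Function.update p e 0) ends o a₁ a₂ a₃ b) ≤
        Gc p ends o a₁ a₂ a₃ b

/-- **(MIX², ∃)** at `p`. -/
def MixChord2Exists (p : E → R) (ends : E → Sym2 V) (o a₁ a₂ a₃ b : V) : Prop :=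
  (Chord.rootEdges p ends a₁ a₂).Nonempty →
    ∃ e ∈ Chord.rootEdges p ends a₁ a₂,
      p e * Gc (Function.update p e 1) ends o a₁ a₂ a₃ b +
        (1 - p e) * (shrink p ends a₁ a₂ a₃ e ^ 2 * Gc (Function.update p e 0) ends o a₁ a₂ a₃ b) ≤
          Gc p ends o a₁ a₂ a₃ b

end Defs

section Shrink

variable {V : Type*} {E : Type*} [Fintype E] [DecidableEq E] {R : Type*} [Field R]
  [LinearOrder R] [IsStrictOrderedRing R]

omit [Fintype E] [DecidableEq E] [LinearOrder R] [IsStrictOrderedRing R] in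
/-- `PD` is a lower set (closing edges keeps `a₁ ↮ a₂` and `a₃ ∉ U`). -/
lemma isLowerSet_PDEvent (ends : E → Sym2 V) (a₁ a₂ a₃ : V) : IsLowerSet (PDEvent ends a₁ a₂ a₃) := by
  unfold PDEvent Dtilde UnionCluster.inU
  exact (isUpperSet_connEvent ends a₁ a₂).compl.inter
    ((isUpperSet_connEvent ends a₃ a₁).union (isUpperSet_connEvent ends a₃ a₂)).compl

/-- The shrinkage is at most `1`: `D` and `Z` do not increase when an edge is opened. -/
lemma shrink_le_one {p : E → R} (hp : IsProbVec p) (ends : E → Sym2 V) (a₁ a₂ a₃ : V) (e : E) :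
    shrink p ends a₁ a₂ a₃ e ≤ 1 := by
  unfold shrink
  have hp0 : IsProbVec (Function.update p e 0) := hp.update e le_rfl zero_le_one
  have hD := EdmRow.prob_le_prob_update_zero_of_isLowerSet hp (isLowerSet_PDEvent ends a₁ a₂ a₃) e
  have hZ := EdmRow.prob_le_prob_update_zero_of_isLowerSet hp (EdmRow.isLowerSet_avoidAll ends a₁ a₂) e
  have hD' := prob_nonneg hp (PDEvent ends a₁ a₂ a₃)
  have hZ' := prob_nonneg hp (avoidAll ends a₂ {a₁})
  by_cases hden : prob (Function.update p e 0) (PDEvent ends a₁ a₂ a₃) *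
      prob (Function.update p e 0) (avoidAll ends a₂ {a₁}) = 0
  · rw [hden, div_zero]; exact zero_le_one
  · have hpos : 0 < prob (Function.update p e 0) (PDEvent ends a₁ a₂ a₃) *
        prob (Function.update p e 0) (avoidAll ends a₂ {a₁}) :=
      lt_of_le_of_ne (mul_nonneg (prob_nonneg hp0 _) (prob_nonneg hp0 _)) (Ne.symm hden)
    rw [div_le_one hpos]
    exact mul_le_mul hD hZ hZ' (prob_nonneg hp0 _)

/-- `shrink² ≤ shrink`. -/
lemma shrink_sq_le {p : E → R} (hp : IsProbVec p) (ends : E → Sym2 V) (a₁ a₂ a₃ : V) (e : E) :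
    shrink p ends a₁ a₂ a₃ e ^ 2 ≤ shrink p ends a₁ a₂ a₃ e := by
  have h0 := shrink_nonneg hp ends a₁ a₂ a₃ e
  have h1 := shrink_le_one hp ends a₁ a₂ a₃ e
  nlinarith

/-- **(MIX-CHORD) along `e` gives (MIX²) along `e` when the closed child has `Gc ≥ 0`.** -/
theorem mixChord2_edge_of_mixChord {p : E → R} (hp : IsProbVec p) (ends : E → Sym2 V)
    (o a₁ a₂ a₃ b : V) (e : E) (h0 : 0 ≤ Gc (Function.update p e 0) ends o a₁ a₂ a₃ b)
    (h : p e * Gc (Function.update p e 1) ends o a₁ a₂ a₃ b +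
      (1 - p e) * (shrink p ends a₁ a₂ a₃ e * Gc (Function.update p e 0) ends o a₁ a₂ a₃ b) ≤
        Gc p ends o a₁ a₂ a₃ b) :
    p e * Gc (Function.update p e 1) ends o a₁ a₂ a₃ b +
      (1 - p e) * (shrink p ends a₁ a₂ a₃ e ^ 2 * Gc (Function.update p e 0) ends o a₁ a₂ a₃ b) ≤
        Gc p ends o a₁ a₂ a₃ b := by
  have hs := shrink_sq_le hp ends a₁ a₂ a₃ e
  have hq : 0 ≤ 1 - p e := sub_nonneg.2 (hp.le_one e)
  have : shrink p ends a₁ a₂ a₃ e ^ 2 * Gc (Function.update p e 0) ends o a₁ a₂ a₃ b ≤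
      shrink p ends a₁ a₂ a₃ e * Gc (Function.update p e 0) ends o a₁ a₂ a₃ b :=
    mul_le_mul_of_nonneg_right hs h0
  nlinarith [mul_le_mul_of_nonneg_left this hq]

end Shrink

section Induction

variable {V : Type*} {E : Type*} [Fintype E] [DecidableEq E] [Fintype V] [DecidableEq V]
  {R : Type*} [Field R] [LinearOrder R] [IsStrictOrderedRing R]

omit [Fintype V] [DecidableEq V] in
/-- **(MIX², ∃) ⟹ `Gc ≥ 0`** (strong induction on the fractional edges). -/
theorem Gc_nonneg_of_mixChord2Exists (ends : E → Sym2 V) (o a₁ a₂ a₃ b : V)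
    (hmix : ∀ q : E → R, IsProbVec q → MixChord2Exists q ends o a₁ a₂ a₃ b) :
    ∀ (n : ℕ) (p : E → R), IsProbVec p → (Chord.frac p).card = n →
      0 ≤ Gc p ends o a₁ a₂ a₃ b := by
  intro n
  induction n using Nat.strong_induction_on with
  | _ n ih =>
  intro p hp hn
  by_cases h0 : Chord.rootEdges p ends a₁ a₂ = ∅
  · rw [Chord.Gc_eq_zero_of_rootEdges_empty h0]
  · obtain ⟨e, he, hle⟩ := hmix p hp (Finset.nonempty_iff_ne_empty.2 h0)
    have hf := Chord.frac_of_mem_rootEdges he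
    have hlt : ((Chord.frac p).erase e).card < n := by
      rw [← hn]
      exact Finset.card_erase_lt_of_mem hf
    have h1 := ih _ hlt _ (hp.update e zero_le_one le_rfl) (by rw [Chord.frac_update_one hf])
    have h2 := ih _ hlt _ (hp.update e le_rfl zero_le_one) (by rw [Chord.frac_update_zero hf])
    exact (add_nonneg (mul_nonneg (hp.nonneg e) h1)
      (mul_nonneg (sub_nonneg.2 (hp.le_one e))
        (mul_nonneg (pow_nonneg (shrink_nonneg hp ends a₁ a₂ a₃ e) 2) h2))).trans hle

/-- A witness-class root edge satisfies (MIX²) when the closed child has `Gc ≥ 0`. -/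
theorem mixChord2_of_witnessClass {p : E → R} {ends : E → Sym2 V} {o a₁ a₂ a₃ b : V} {e : E}
    (hp : IsProbVec p) (he : e ∈ Chord.rootEdges p ends a₁ a₂)
    (hw : WitnessClass p ends a₁ a₂ a₃ e) (h0 : 0 ≤ Gc (Function.update p e 0) ends o a₁ a₂ a₃ b) :
    p e * Gc (Function.update p e 1) ends o a₁ a₂ a₃ b +
      (1 - p e) * (shrink p ends a₁ a₂ a₃ e ^ 2 * Gc (Function.update p e 0) ends o a₁ a₂ a₃ b) ≤
        Gc p ends o a₁ a₂ a₃ b :=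
  mixChord2_edge_of_mixChord hp ends o a₁ a₂ a₃ b e h0 (mixChord_of_witnessClass hp he hw)

end Induction

section All

variable (R : Type*) [Field R] [LinearOrder R] [IsStrictOrderedRing R]

/-- Row (MIX², ∃) over all instances. -/
def MixChord2Exists_all : Prop :=
  ∀ (V E : Type) [Fintype V] [DecidableEq V] [Fintype E] [DecidableEq E]
    (ends : E → Sym2 V) (p : E → R), IsProbVec p →
    ∀ o a₁ a₂ a₃ b : V, a₁ ≠ a₂ → a₁ ≠ a₃ → a₂ ≠ a₃ → o ≠ a₁ → o ≠ a₂ → o ≠ a₃ → o ≠ b →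
      b ≠ a₁ → b ≠ a₂ → b ≠ a₃ → MixChord2Exists p ends o a₁ a₂ a₃ b

/-- Row (MIX²) along EVERY root edge, assumed only at the vectors with no witness-class root edge. -/
def MixChord2NoWitness_all : Prop :=
  ∀ (V E : Type) [Fintype V] [DecidableEq V] [Fintype E] [DecidableEq E]
    (ends : E → Sym2 V) (p : E → R), IsProbVec p →
    ∀ o a₁ a₂ a₃ b : V, a₁ ≠ a₂ → a₁ ≠ a₃ → a₂ ≠ a₃ → o ≠ a₁ → o ≠ a₂ → o ≠ a₃ → o ≠ b →
      b ≠ a₁ → b ≠ a₂ → b ≠ a₃ →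
      (∀ e ∈ Chord.rootEdges p ends a₁ a₂, ¬ WitnessClass p ends a₁ a₂ a₃ e) →
      MixChord2 p ends o a₁ a₂ a₃ b

/-- **(MIX², ∃) on all instances ⟹ the crux.** -/
theorem HCov_all_of_mixChord2Exists_all (h : MixChord2Exists_all R) : HCov_all R := by
  intro V E _ _ _ _ ends p hp o a₁ a₂ a₃ b h12 h13 h23 ho1 ho2 ho3 hob hb1 hb2 hb3
  exact Gc_nonneg_of_mixChord2Exists ends o a₁ a₂ a₃ b
    (fun q hq => h V E ends q hq o a₁ a₂ a₃ b h12 h13 h23 ho1 ho2 ho3 hob hb1 hb2 hb3) _ p hp rfl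

/-- **The crux from (MIX²) along every root edge at the vectors without a witness-class root
edge** — the induction supplies `Gc ≥ 0` at the closed child for the witness classes. -/
theorem HCov_all_of_mixChord2NoWitness_all (h : MixChord2NoWitness_all R) : HCov_all R := by
  intro V E _ _ _ _ ends p hp o a₁ a₂ a₃ b h12 h13 h23 ho1 ho2 ho3 hob hb1 hb2 hb3
  -- strong induction on the fractional edges, choosing a witness-class edge when one exists
  suffices key : ∀ (n : ℕ) (q : E → R), IsProbVec q → (Chord.frac q).card = n →
      0 ≤ Gc q ends o a₁ a₂ a₃ b from key _ p hp rfl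
  intro n
  induction n using Nat.strong_induction_on with
  | _ n ih =>
  intro q hq hn
  by_cases h0 : Chord.rootEdges q ends a₁ a₂ = ∅
  · rw [Chord.Gc_eq_zero_of_rootEdges_empty h0]
  · have step : ∀ e ∈ Chord.rootEdges q ends a₁ a₂,
        (q e * Gc (Function.update q e 1) ends o a₁ a₂ a₃ b +
          (1 - q e) * (shrink q ends a₁ a₂ a₃ e ^ 2 *
            Gc (Function.update q e 0) ends o a₁ a₂ a₃ b) ≤ Gc q ends o a₁ a₂ a₃ b) →
        0 ≤ Gc q ends o a₁ a₂ a₃ b := by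
      intro e he hle
      have hf := Chord.frac_of_mem_rootEdges he
      have hlt : ((Chord.frac q).erase e).card < n := by
        rw [← hn]
        exact Finset.card_erase_lt_of_mem hf
      have h1 := ih _ hlt _ (hq.update e zero_le_one le_rfl) (by rw [Chord.frac_update_one hf])
      have h2 := ih _ hlt _ (hq.update e le_rfl zero_le_one) (by rw [Chord.frac_update_zero hf])
      exact (add_nonneg (mul_nonneg (hq.nonneg e) h1)
        (mul_nonneg (sub_nonneg.2 (hq.le_one e))
          (mul_nonneg (pow_nonneg (shrink_nonneg hq ends a₁ a₂ a₃ e) 2) h2))).trans hle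
    by_cases hw : ∃ e ∈ Chord.rootEdges q ends a₁ a₂, WitnessClass q ends a₁ a₂ a₃ e
    · obtain ⟨e, he, hwe⟩ := hw
      have hf := Chord.frac_of_mem_rootEdges he
      have hlt : ((Chord.frac q).erase e).card < n := by
        rw [← hn]
        exact Finset.card_erase_lt_of_mem hf
      have h2 := ih _ hlt _ (hq.update e le_rfl zero_le_one) (by rw [Chord.frac_update_zero hf])
      exact step e he (mixChord2_of_witnessClass hq he hwe h2)
    · push Not at hw
      obtain ⟨e, he⟩ := Finset.nonempty_iff_ne_empty.2 h0
      exact step e he (h V E ends q hq o a₁ a₂ a₃ b h12 h13 h23 ho1 ho2 ho3 hob hb1 hb2 hb3 hw e he)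

end All

end Mix

end Summit.Ventures.PercRepro2
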